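import Mathlib

/-!
# Log-concave tails on `ℤ` and a 2×2 Cauchy–Binet identity (seat mine-b, cell pub-perc-repro2)

Discrete IFR (increasing failure rate) tails: `IsLCTail F N` — `F k = 1` for `k ≤ 0`, non-increasing,
non-negative, log-concave, vanishing for `k ≥ N` — with the balanced-pair and hazard-rate lemmas, and the
2×2 Cauchy–Binet identity for finite sums.  These are the ingredients of the discrete IFR convolution
theorem (`IFRConv.lean`), the analytic core of the series–parallel case of row B2 of conjectures/MINE-B.md
(log-concavity of the max-flow tail; proofs/MINE-B-FLOW-IFR-SP.md).
-/

open Finset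

namespace Summit.Ventures.PercRepro2.IFR

/-- the four axioms of a log-concave tail on `ℤ` (support bounded by `N`) -/
structure IsLCTail (F : ℤ → ℝ) (N : ℤ) : Prop where
  one : ∀ k, k ≤ 0 → F k = 1
  nonneg : ∀ k, 0 ≤ F k
  anti : ∀ k, F (k + 1) ≤ F k
  lc : ∀ k, F (k - 1) * F (k + 1) ≤ F k * F k
  vanish : ∀ k, N ≤ k → F k = 0

namespace IsLCTail

variable {F : ℤ → ℝ} {N : ℤ} (hF : IsLCTail F N)

/-- the pmf -/
def pmf (F : ℤ → ℝ) (k : ℤ) : ℝ := F k - F (k + 1)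

include hF

/-- the pmf of a tail is non-negative (the tail is non-increasing) -/
lemma pmf_nonneg (k : ℤ) : 0 ≤ pmf F k := by
  unfold pmf; linarith [hF.anti k]

/-- a tail is non-increasing on `ℤ` -/
lemma anti_of_le {a b : ℤ} (h : a ≤ b) : F b ≤ F a := by
  have key : ∀ n : ℕ, F (a + n) ≤ F a := by
    intro n
    induction n with
    | zero => simp
    | succ n ih =>
      have h1 := hF.anti (a + n)
      have e : a + ((n + 1 : ℕ) : ℤ) = a + n + 1 := by push_cast; ring
      rw [e]; exact le_trans h1 ih
  obtain ⟨n, rfl⟩ : ∃ n : ℕ, b = a + n := ⟨(b - a).toNat, by omega⟩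
  exact key n

/-- a tail that vanishes at `a` vanishes at every `b ≥ a` -/
lemma eq_zero_of_le_zero {a b : ℤ} (h : a ≤ b) (ha : F a = 0) : F b = 0 :=
  le_antisymm (ha ▸ hF.anti_of_le h) (hF.nonneg b)

/-- one-step spreading: `F a * F (a + n + 2) ≤ F (a + 1) * F (a + n + 1)`. -/
lemma one_step (a : ℤ) (n : ℕ) : F a * F (a + n + 2) ≤ F (a + 1) * F (a + n + 1) := by
  induction n with
  | zero =>
    have := hF.lc (a + 1)
    have e1 : a + 1 - 1 = a := by ring
    have e2 : a + ((0 : ℕ) : ℤ) + 2 = a + 1 + 1 := by push_cast; ring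
    have e3 : a + ((0 : ℕ) : ℤ) + 1 = a + 1 := by push_cast; ring
    rw [e1] at this; rw [e2, e3]; exact this
  | succ n ih =>
    have hlc := hF.lc (a + n + 2)
    have e1 : a + n + 2 - 1 = a + n + 1 := by ring
    have e2 : a + n + 2 + 1 = a + ((n + 1 : ℕ) : ℤ) + 2 := by push_cast; ring
    have e3 : a + ((n + 1 : ℕ) : ℤ) + 1 = a + n + 2 := by push_cast; ring
    rw [e1, e2] at hlc
    rw [e3]
    by_cases h2 : F (a + n + 2) = 0
    · have : F (a + ((n + 1 : ℕ) : ℤ) + 2) = 0 :=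
        hF.eq_zero_of_le_zero (by push_cast; linarith) h2
      rw [this, h2]; simp
    by_cases h1 : F (a + n + 1) = 0
    · have : F (a + ((n + 1 : ℕ) : ℤ) + 2) = 0 :=
        hF.eq_zero_of_le_zero (by push_cast; linarith) h1
      rw [this]; simp [mul_nonneg (hF.nonneg _) (hF.nonneg _)]
    have p1 : 0 < F (a + n + 1) := lt_of_le_of_ne (hF.nonneg _) (Ne.symm h1)
    have p2 : 0 < F (a + n + 2) := lt_of_le_of_ne (hF.nonneg _) (Ne.symm h2)
    have key : F a * F (a + n + 2) * (F (a + n + 1) * F (a + ((n + 1 : ℕ) : ℤ) + 2))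
        ≤ F (a + 1) * F (a + n + 1) * (F (a + n + 2) * F (a + n + 2)) :=
      mul_le_mul ih hlc (mul_nonneg (hF.nonneg _) (hF.nonneg _))
        (mul_nonneg (hF.nonneg _) (hF.nonneg _))
    have hpos : 0 < F (a + n + 1) * F (a + n + 2) := mul_pos p1 p2
    have : (F a * F (a + ((n + 1 : ℕ) : ℤ) + 2)) * (F (a + n + 1) * F (a + n + 2))
        ≤ (F (a + 1) * F (a + n + 2)) * (F (a + n + 1) * F (a + n + 2)) := by
      calc (F a * F (a + ((n + 1 : ℕ) : ℤ) + 2)) * (F (a + n + 1) * F (a + n + 2))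
          = F a * F (a + n + 2) * (F (a + n + 1) * F (a + ((n + 1 : ℕ) : ℤ) + 2)) := by ring
        _ ≤ F (a + 1) * F (a + n + 1) * (F (a + n + 2) * F (a + n + 2)) := key
        _ = (F (a + 1) * F (a + n + 2)) * (F (a + n + 1) * F (a + n + 2)) := by ring
    exact le_of_mul_le_mul_right this hpos

/-- `m`-step spreading: `F a * F (a + n + 2m) ≤ F (a + m) * F (a + n + m)`. -/
lemma spread (m : ℕ) : ∀ (a : ℤ) (n : ℕ), F a * F (a + n + 2 * m) ≤ F (a + m) * F (a + n + m) := by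
  induction m with
  | zero => intro a n; simp
  | succ m ih =>
    intro a n
    have s1 : F a * F (a + n + 2 * ((m + 1 : ℕ) : ℤ)) ≤ F (a + 1) * F ((a + 1) + n + 2 * (m : ℤ)) := by
      have := hF.one_step a (n + 2 * m)
      have e1 : a + ((n + 2 * m : ℕ) : ℤ) + 2 = a + n + 2 * ((m + 1 : ℕ) : ℤ) := by push_cast; ring
      have e2 : a + ((n + 2 * m : ℕ) : ℤ) + 1 = (a + 1) + n + 2 * (m : ℤ) := by push_cast; ring
      rw [e1, e2] at this; exact this
    have s2 := ih (a + 1) n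
    have e3 : (a + 1) + m = a + ((m + 1 : ℕ) : ℤ) := by push_cast; ring
    have e4 : (a + 1) + n + m = a + n + ((m + 1 : ℕ) : ℤ) := by push_cast; ring
    rw [e3, e4] at s2
    exact le_trans s1 s2

/-- balanced pairs: `a ≤ b`, `a ≤ c`, `a + d = b + c` ⇒ `F a * F d ≤ F b * F c`. -/
lemma balanced4 {a b c d : ℤ} (hab : a ≤ b) (hac : a ≤ c) (hsum : a + d = b + c) :
    F a * F d ≤ F b * F c := by
  rcases le_total b c with hbc | hcb
  · obtain ⟨m, hm⟩ : ∃ m : ℕ, b = a + m := ⟨(b - a).toNat, by omega⟩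
    obtain ⟨n, hn⟩ : ∃ n : ℕ, c = b + n := ⟨(c - b).toNat, by omega⟩
    have hd : d = a + n + 2 * (m : ℤ) := by omega
    have hc : c = a + n + m := by omega
    rw [hd, hm, hc]; exact hF.spread m a n
  · obtain ⟨m, hm⟩ : ∃ m : ℕ, c = a + m := ⟨(c - a).toNat, by omega⟩
    obtain ⟨n, hn⟩ : ∃ n : ℕ, b = c + n := ⟨(b - c).toNat, by omega⟩
    have hd : d = a + n + 2 * (m : ℤ) := by omega
    have hb : b = a + n + m := by omega
    rw [hd, hm, hb, mul_comm (F (a + n + m))]; exact hF.spread m a n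

/-- hazard monotonicity: for `j ≤ j'`, `pmf j * F j' ≤ pmf j' * F j`. -/
lemma hazard {j j' : ℤ} (h : j ≤ j') : pmf F j * F j' ≤ pmf F j' * F j := by
  unfold pmf
  have : F j * F (j' + 1) ≤ F (j + 1) * F j' := hF.balanced4 (by omega) (by omega) (by ring)
  nlinarith [this]

end IsLCTail


section CauchyBinet
variable {ι : Type*} [LinearOrder ι]

/-- the summand of the double sum -/
private def T (a b c d : ι → ℝ) (s₁ s₂ : ι) : ℝ := a s₁ * b s₂ * (c s₁ * d s₂ - d s₁ * c s₂)

omit [LinearOrder ι] in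
/-- the summand and its swap combine into the Cauchy–Binet product -/
private lemma T_add_swap (a b c d : ι → ℝ) (s₁ s₂ : ι) :
    T a b c d s₁ s₂ + T a b c d s₂ s₁ =
      (a s₁ * b s₂ - a s₂ * b s₁) * (c s₁ * d s₂ - c s₂ * d s₁) := by
  unfold T; ring

omit [LinearOrder ι] in
/-- the diagonal summand vanishes -/
private lemma T_diag (a b c d : ι → ℝ) (s : ι) : T a b c d s s = 0 := by
  unfold T; ring

omit [LinearOrder ι] in
/-- The left-hand side as a double sum. -/
private lemma lhs_eq_double (I : Finset ι) (a b c d : ι → ℝ) :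
    (∑ s ∈ I, a s * c s) * (∑ s ∈ I, b s * d s) - (∑ s ∈ I, a s * d s) * (∑ s ∈ I, b s * c s)
      = ∑ s₁ ∈ I, ∑ s₂ ∈ I, T a b c d s₁ s₂ := by
  rw [Finset.sum_mul_sum, Finset.sum_mul_sum, ← Finset.sum_sub_distrib]
  refine Finset.sum_congr rfl (fun s₁ _ => ?_)
  rw [← Finset.sum_sub_distrib]
  refine Finset.sum_congr rfl (fun s₂ _ => ?_)
  unfold T; ring

/-- Split a double sum over `I × I` into the strict upper part, the strict lower part and the diagonal. -/
private lemma double_split (I : Finset ι) (f : ι → ι → ℝ) :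
    ∑ s₁ ∈ I, ∑ s₂ ∈ I, f s₁ s₂
      = (∑ s₁ ∈ I, ∑ s₂ ∈ I.filter (fun s₂ => s₁ < s₂), f s₁ s₂)
        + (∑ s₁ ∈ I, ∑ s₂ ∈ I.filter (fun s₂ => s₂ < s₁), f s₁ s₂)
        + ∑ s₁ ∈ I, f s₁ s₁ := by
  have h : ∀ s₁ ∈ I, ∑ s₂ ∈ I, f s₁ s₂
      = (∑ s₂ ∈ I.filter (fun s₂ => s₁ < s₂), f s₁ s₂)
        + (∑ s₂ ∈ I.filter (fun s₂ => s₂ < s₁), f s₁ s₂) + f s₁ s₁ := by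
    intro s₁ hs₁
    have h1 : ∑ s₂ ∈ I, f s₁ s₂ = (∑ s₂ ∈ I.filter (fun s₂ => s₁ < s₂), f s₁ s₂)
        + ∑ s₂ ∈ I.filter (fun s₂ => ¬ s₁ < s₂), f s₁ s₂ :=
      (Finset.sum_filter_add_sum_filter_not I (fun s₂ => s₁ < s₂) _).symm
    have h2 : ∑ s₂ ∈ I.filter (fun s₂ => ¬ s₁ < s₂), f s₁ s₂
        = (∑ s₂ ∈ I.filter (fun s₂ => s₂ < s₁), f s₁ s₂) + f s₁ s₁ := by
      rw [← Finset.sum_filter_add_sum_filter_not (I.filter (fun s₂ => ¬ s₁ < s₂)) (fun s₂ => s₂ < s₁)]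
      have e1 : (I.filter (fun s₂ => ¬ s₁ < s₂)).filter (fun s₂ => s₂ < s₁)
          = I.filter (fun s₂ => s₂ < s₁) := by
        ext s₂; simp only [Finset.mem_filter, not_lt]; constructor
        · rintro ⟨⟨h1, _⟩, h3⟩; exact ⟨h1, h3⟩
        · rintro ⟨h1, h3⟩; exact ⟨⟨h1, h3.le⟩, h3⟩
      have e2 : (I.filter (fun s₂ => ¬ s₁ < s₂)).filter (fun s₂ => ¬ s₂ < s₁) = {s₁} := by
        ext s₂; simp only [Finset.mem_filter, Finset.mem_singleton, not_lt]
        constructor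
        · rintro ⟨⟨_, h2⟩, h3⟩; exact le_antisymm h2 h3
        · rintro rfl; exact ⟨⟨hs₁, le_rfl⟩, le_rfl⟩
      rw [e1, e2, Finset.sum_singleton]
    rw [h1, h2, add_assoc]
  rw [Finset.sum_congr rfl h, Finset.sum_add_distrib, Finset.sum_add_distrib]

/-- The strict lower part equals the strict upper part with the arguments swapped. -/
private lemma lower_eq_upper_swap (I : Finset ι) (f : ι → ι → ℝ) :
    (∑ s₁ ∈ I, ∑ s₂ ∈ I.filter (fun s₂ => s₂ < s₁), f s₁ s₂)
      = ∑ s₁ ∈ I, ∑ s₂ ∈ I.filter (fun s₂ => s₁ < s₂), f s₂ s₁ := by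
  rw [Finset.sum_sigma', Finset.sum_sigma']
  refine Finset.sum_bij' (fun x _ => ⟨x.2, x.1⟩) (fun x _ => ⟨x.2, x.1⟩) ?_ ?_ ?_ ?_ ?_
  all_goals intro x hx
  all_goals first
    | rfl
    | (simp only [Finset.mem_sigma, Finset.mem_filter] at hx ⊢; exact ⟨hx.2.1, hx.1, hx.2.2⟩)

/-- **2×2 Cauchy–Binet** over a finite index set. -/
theorem cauchy_binet_two (I : Finset ι) (a b c d : ι → ℝ) :
    (∑ s ∈ I, a s * c s) * (∑ s ∈ I, b s * d s) - (∑ s ∈ I, a s * d s) * (∑ s ∈ I, b s * c s)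
      = ∑ s₁ ∈ I, ∑ s₂ ∈ I.filter (fun s₂ => s₁ < s₂),
          (a s₁ * b s₂ - a s₂ * b s₁) * (c s₁ * d s₂ - c s₂ * d s₁) := by
  rw [lhs_eq_double, double_split, lower_eq_upper_swap]
  simp only [T_diag, Finset.sum_const_zero, add_zero]
  rw [← Finset.sum_add_distrib]
  refine Finset.sum_congr rfl (fun s₁ _ => ?_)
  rw [← Finset.sum_add_distrib]
  refine Finset.sum_congr rfl (fun s₂ _ => ?_)
  exact T_add_swap a b c d s₁ s₂

end CauchyBinet

end Summit.Ventures.PercRepro2.IFR
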